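import Mathlib.Algebra.Order.Chebyshev
import Mathlib.Combinatorics.Enumerative.DoubleCounting
import Mathlib.Tactic.Linarith
import Mathlib.Tactic.Ring
import HarnessLib

/-!
# `NoHeavyLowerTail` (crux stmt-CriticalPhenomena-4575), P3 lane: Mantel's theorem for a finset of pairs

Support file (seat `prim-l12-p3`, gen 26; `--supports stmt-CriticalPhenomena-4575`).  Used by the α = 0 half of the row `#dbl = 3` of
`(L_3)` (paper proof `prim-l12-p3/ROW3-PROOF-g26.md` §3 (L2-M), §6): a family `E` of 2-subsets of an `n`-set `V` without a triangle has
`4·#E ≤ n²` (`four_mul_card_le_sq_of_triangleFree`), equivalently more than `n²/4` edges force a triangle (`exists_triangle_of_sq_lt`).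
Elementary proof (degrees of the two ends of an edge sum to at most `n`, then Cauchy–Schwarz), stated for `Finset (Finset α)` rather than
`SimpleGraph` to match the set-system language of the lane.  [folklore: Mantel 1907]  Nothing is asserted about the crux.
-/

namespace Summit.CriticalPhenomena.PercolationContinuityZ3.Theorems.SahiCTCForms

open Finset

variable {α : Type*} [DecidableEq α]

section Mantel

/-- The degree of `v` in a family of pairs. [folklore] -/
def pdeg (E : Finset (Finset α)) (v : α) : ℕ := #(E.filter fun e => v ∈ e)

/-- Handshake for a family of 2-subsets of `V`: `Σ_{v ∈ V} deg v = 2·#E`. [folklore] -/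
theorem sum_pdeg_eq {V : Finset α} {E : Finset (Finset α)} (hE : ∀ e ∈ E, e ⊆ V ∧ #e = 2) :
    ∑ v ∈ V, pdeg E v = 2 * #E := by
  unfold pdeg
  have h := sum_card_bipartiteAbove_eq_sum_card_bipartiteBelow (s := V) (t := E) (r := fun v e => v ∈ e)
  simp only [bipartiteAbove, bipartiteBelow] at h
  rw [h]
  have : ∀ e ∈ E, #(V.filter fun v => v ∈ e) = 2 := fun e he => by
    rw [show (V.filter fun v => v ∈ e) = e from by
      ext v; simp only [mem_filter, and_iff_right_iff_imp]; exact fun hv => (hE e he).1 hv, (hE e he).2]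
  rw [sum_congr rfl this, sum_const, smul_eq_mul, mul_comm]

/-- The degree of `v` equals the number of its neighbours. [folklore] -/
theorem pdeg_eq_card_nbrs {V : Finset α} {E : Finset (Finset α)} (hE : ∀ e ∈ E, e ⊆ V ∧ #e = 2) (v : α) :
    pdeg E v = #(V.filter fun u => u ≠ v ∧ ({v, u} : Finset α) ∈ E) := by
  unfold pdeg
  symm
  refine card_bij (fun u _ => ({v, u} : Finset α)) (fun u hu => ?_) (fun u hu u' hu' h => ?_) (fun e he => ?_)
  · obtain ⟨_, _, h⟩ := mem_filter.1 hu
    exact mem_filter.2 ⟨h, mem_insert_self _ _⟩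
  · obtain ⟨_, hne, _⟩ := mem_filter.1 hu
    have : u ∈ ({v, u'} : Finset α) := by rw [← show ({v, u} : Finset α) = {v, u'} from h]; simp
    rcases mem_insert.1 this with h' | h'
    · exact absurd h' hne
    · exact mem_singleton.1 h'
  · obtain ⟨heE, hve⟩ := mem_filter.1 he
    obtain ⟨heV, he2⟩ := hE e heE
    obtain ⟨u, hu⟩ : (e.erase v).Nonempty := card_pos.1 (by rw [card_erase_of_mem hve, he2]; norm_num)
    have heq : ({v, u} : Finset α) = e := by
      apply eq_of_subset_of_card_le (insert_subset hve (singleton_subset_iff.2 (mem_of_mem_erase hu)))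
      rw [he2, card_pair (ne_of_mem_erase hu).symm]
    exact ⟨u, mem_filter.2 ⟨heV (mem_of_mem_erase hu), ne_of_mem_erase hu, heq ▸ heE⟩, heq⟩

/-- In a triangle-free family of pairs the degrees of the two ends of an edge sum to at most `#V`. [folklore] -/
theorem pdeg_add_pdeg_le {V : Finset α} {E : Finset (Finset α)} (hE : ∀ e ∈ E, e ⊆ V ∧ #e = 2)
    (hfree : ∀ x y z : α, ({x, y} : Finset α) ∈ E → ({y, z} : Finset α) ∈ E → ({x, z} : Finset α) ∈ E → False)
    {u v : α} (huv : ({u, v} : Finset α) ∈ E) : pdeg E u + pdeg E v ≤ #V := by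
  rw [pdeg_eq_card_nbrs hE u, pdeg_eq_card_nbrs hE v, ← card_union_of_disjoint]
  · exact card_le_card (union_subset (filter_subset _ _) (filter_subset _ _))
  · rw [disjoint_left]; intro w hwu hwv
    obtain ⟨_, _, hu⟩ := mem_filter.1 hwu
    obtain ⟨_, _, hv⟩ := mem_filter.1 hwv
    -- triangle u v w : {u,v}, {v,w}, {u,w} ∈ E
    exact hfree u v w huv hv hu

/-- **Mantel's theorem**: a triangle-free family of 2-subsets of `V` has `4·#E ≤ #V²`. [folklore: Mantel 1907] -/
theorem four_mul_card_le_sq_of_triangleFree {V : Finset α} {E : Finset (Finset α)} (hE : ∀ e ∈ E, e ⊆ V ∧ #e = 2)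
    (hfree : ∀ x y z : α, ({x, y} : Finset α) ∈ E → ({y, z} : Finset α) ∈ E → ({x, z} : Finset α) ∈ E → False) :
    4 * #E ≤ #V ^ 2 := by
  -- Σ_{e ∈ E} Σ_{v ∈ e} deg v ≤ #E·#V
  have h1 : ∑ e ∈ E, ∑ v ∈ e, pdeg E v ≤ #E * #V := by
    have : ∀ e ∈ E, ∑ v ∈ e, pdeg E v ≤ #V := fun e he => by
      obtain ⟨heV, he2⟩ := hE e he
      obtain ⟨u, v, huv, rfl⟩ := card_eq_two.1 he2
      rw [sum_pair huv]
      exact pdeg_add_pdeg_le hE hfree he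
    exact (sum_le_sum this).trans (by rw [sum_const, smul_eq_mul])
  -- Σ_{e ∈ E} Σ_{v ∈ e} deg v = Σ_{v ∈ V} deg v²
  have h2 : ∑ e ∈ E, ∑ v ∈ e, pdeg E v = ∑ v ∈ V, pdeg E v ^ 2 := by
    have : ∀ e ∈ E, ∑ v ∈ e, pdeg E v = ∑ v ∈ V, if v ∈ e then pdeg E v else 0 := fun e he => by
      rw [← sum_filter, show (V.filter fun v => v ∈ e) = e from by
        ext v; simp only [mem_filter, and_iff_right_iff_imp]; exact fun hv => (hE e he).1 hv]
    rw [sum_congr rfl this, sum_comm]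
    refine sum_congr rfl fun v _ => ?_
    rw [← sum_filter, sum_const, smul_eq_mul, sq]; rfl
  -- Cauchy–Schwarz
  have h3 := sq_sum_le_card_mul_sum_sq (s := V) (f := fun v => pdeg E v)
  rw [sum_pdeg_eq hE] at h3
  -- combine: (2#E)² ≤ #V · Σ deg² = #V · Σ_e Σ_v deg ≤ #V · #E · #V
  have h4 : (2 * #E) ^ 2 ≤ #V * (#E * #V) := h3.trans (by rw [← h2]; exact Nat.mul_le_mul_left _ h1)
  rcases Nat.eq_zero_or_pos #E with h0 | hpos
  · rw [h0]; exact Nat.zero_le _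
  · nlinarith [h4]

/-- Contrapositive: more than `#V²/4` pairs contain a triangle. [folklore: Mantel 1907] -/
theorem exists_triangle_of_sq_lt {V : Finset α} {E : Finset (Finset α)} (hE : ∀ e ∈ E, e ⊆ V ∧ #e = 2)
    (hbig : #V ^ 2 < 4 * #E) :
    ∃ x y z : α, x ≠ y ∧ y ≠ z ∧ x ≠ z ∧ ({x, y} : Finset α) ∈ E ∧ ({y, z} : Finset α) ∈ E ∧ ({x, z} : Finset α) ∈ E := by
  by_contra h
  push Not at h
  have : 4 * #E ≤ #V ^ 2 := four_mul_card_le_sq_of_triangleFree hE fun x y z hxy hyz hxz => by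
    have hne : ∀ {a b : α}, ({a, b} : Finset α) ∈ E → a ≠ b := fun {a b} hab heq => by
      have := (hE _ hab).2; rw [heq, pair_eq_singleton, card_singleton] at this; exact absurd this (by norm_num)
    exact absurd hxz (h x y z (hne hxy) (hne hyz) (hne hxz) hxy hyz)
  omega

end Mantel

end Summit.CriticalPhenomena.PercolationContinuityZ3.Theorems.SahiCTCForms
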